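import Literature.AlgebraicGeometry.Hyperkaehler.KummerTypeAssociatedK3Surface
import HarnessLib

/-!
# Hodge similitudes of transcendental lattices of two K3 surfaces are algebraic once their Kuga–Satake correspondences are (Varesco, Math. Z. 305 (2023), Thm. 5.3) — NAMED FACT

Layer `Literature/AlgebraicGeometry/Surfaces`.  CITE record for the cross-ladder literature-typing layer
(D-0088(4), tranche LT-H4, seat `hodge-lit-oqh-2`, generation 3): the K3-SURFACE case of Varesco's
Cor. 4.6, in the surface vocabulary of the tree (`IsK3Surface`, `HodgeTheory.IsKSCorrespondenceAlgebraicBetti`,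
`transcendentalSubspace`), left in the "Not here" of `Hyperkaehler/TranscendentalHodgeSimilitudesKugaSatake`
(where Thm. 4.5 / Cor. 4.6 / Thm. 5.1 are recorded on the `2n`-dimensional carriers).  Consumers BY NAME:
the Kuga–Satake road of the summit `HodgeConjecture` (its K3 statements are on
`IsKSCorrespondenceAlgebraicBetti`) and route `NikulinTwinTransport` (crux «rational Hodge
`2`-similitudes of projective K3 surfaces are algebraic»; its thesis cites this theorem as "known
conditionally: Varesco 2023 — Kuga–Satake for both sides ⇒ all Hodge similarities algebraic").

HONEST FRAMING: typed ≠ proved ≠ endorsed; an IMPLICATION printed and proved in a refereed journal,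
whose antecedent is the tree's open Kuga–Satake predicate for the two surfaces; nothing is asserted
about any K3 surface.

## Source (read at source; locators = files of the materialised arXiv text `paper:arxiv-2304.02519`)

* [Var23] M. Varesco, *Hodge similarities, algebraic classes, and Kuga–Satake varieties*, Math. Z. 305
  (2023), art. 69 (arXiv:2304.02519) [`Varesco2023`; REFEREED].  §5 [corpus:paper-arxiv-2304.02519
  p0017:L39–L43], verbatim: "Let us briefly comment on the application of our result to the case of
  K3 surfaces. In this case, the Lefschetz standard conjecture is trivially true. Hence, applying
  Corollary 4.6, we get the following: **Theorem 5.3.** Let `S` and `S'` be K3 surfaces for which the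
  Kuga–Satake Hodge conjecture holds. Then, every Hodge similarity between `T(S)` and `T(S')` is
  algebraic."  [p0017:L45–L47]: "For K3 surfaces, the Kuga–Satake Hodge conjecture is in general not
  known. However, in [Floccari 2024], the author proves it for the (countably many) four-dimensional
  families of K3 surfaces with transcendental lattice isometric to `T(K)(2)` for a hyperkähler manifold
  `K` of generalized Kummer type of dimension six" (the tree's
  `Surfaces.Floccari2026_kugaSatakeCorrespondence_algebraic_of_K3_of_transcendental_embedding`).
  Conventions, Def. 1.2 (Hodge similarity of polarised K3-type Hodge structures, multiplier `λ ∈ ℚˣ`),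
  Conj. 4.2 / Rem. 4.1 / Rem. 4.3 and Cor. 4.6: see the module docstring of
  `Hyperkaehler/TranscendentalHodgeSimilitudesKugaSatake` ([p0007:L3–L54], [p0015:L5–L22],
  [p0016:L67–L69]); Intro [p0004:L45–L46]: "In the case of K3 surfaces, the Lefschetz standard conjecture
  is trivially true. Hence, if the Kuga–Satake Hodge conjecture holds for two given K3 surfaces, Theorem
  3 shows that every Hodge similarity between their transcendental lattices is algebraic."

## Rendering (tree carriers) and faithfulness

* "K3 surface" ([Var23] §1: all varieties projective): `Surfaces.IsK3Surface S` (smooth projective,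
  `H¹(𝒪) = 0`, trivial canonical bundle).
* "the Kuga–Satake Hodge conjecture holds for `S`": the tree's SURFACE predicate
  `HodgeTheory.IsKSCorrespondenceAlgebraicBetti hS.isSmoothProjective` (Floccari 2026 (3.3) in the
  `H²_tr`-form of his Rem. 3.4; [Var23] Conj. 4.2 is the `H²`-form, equivalent by his Rem. 4.1 — neither
  stronger nor weaker).
* "`T(S)`": `Hyperkaehler.transcendentalPart S b = NS(S)^{⊥_b} ⊗ ℂ` for a Fujiki form `b` with `n = 1`
  (`Hyperkaehler.IsFujikiForm 1 S b`: the intersection form up to `ℂˣ`), which IS the tree's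
  cup-orthogonal `Surfaces.transcendentalSubspace S` (`Hyperkaehler.transcendentalPart_eq_transcendentalSubspace`,
  proved) — so that the record is literally the `n₁ = n₂ = 1` shape of the `2n`-dimensional records and
  reads on the K3 carriers (kernel lemma `….of_transcendentalSubspace` below).
* "Hodge similarity `ψ : T(S) → T(S')`": as in the `2n`-dimensional records — `ψ : H²(S(ℂ); ℂ) →
  H²(S'(ℂ); ℂ)` rational on, bijective from, type-preserving on, and isometric (for the pair `b`, `b'`
  — multiplier absorbed in the free scalars; value unrecorded, WEAKER only there) on
  `transcendentalPart S b` onto `transcendentalPart S' b'`.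
* "is algebraic": some `T : H²(S(ℂ); ℂ) → H²(S'(ℂ); ℂ)` induced by an algebraic cycle on `S' × S`
  (`HodgeTheory.IsAlgebraicCorrespondence 2 2 S' S T`, `ℂ`-span convention) agrees with `ψ` on
  `transcendentalPart S b`.  No Lefschetz hypothesis ("trivially true": `h_S^{2·1-2} ∪ ·` is the identity).

## Content and D-0026 accounting

One named fact (+1; absent: `lean search 'similitude|Similar|IsKSCorrespondenceAlgebraicBetti'` in
`Surfaces/`, `HodgeTheory/` finds Buskin's ISOMETRY theorem `Surfaces.Buskin2019_hodgeIsometry_algebraic`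
(unconditional, multiplier `1`) and the Kuga–Satake records, no conditional similitude statement):
`Varesco2023_transcendentalHodgeSimilitude_algebraic_of_kugaSatake_K3`.  Kernel: the
`transcendentalSubspace` spelling.  Not here: [Var23] §2 (K3 surfaces with a symplectic automorphism:
unconditional algebraic similitudes of multiplier `p` on the Nikulin-type loci, Thms. 2.x); the Hodge
conjecture for `S × S'`; any proof.
-/

noncomputable section

open CategoryTheory _root_.AlgebraicGeometry
open Literature.AlgebraicTopology.SingularHomology
open Literature.AlgebraicGeometry.Hyperkaehler (IsFujikiForm transcendentalPart
  transcendentalPart_eq_transcendentalSubspace)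

namespace Literature.AlgebraicGeometry.Surfaces

open HodgeTheory

/-- **Varesco 2023, Theorem 5.3 — for two projective K3 surfaces whose Kuga–Satake correspondences are
algebraic, every Hodge similitude of their rational transcendental lattices is induced by an algebraic
cycle.**  Print (verbatim in the module docstring): "Let `S` and `S'` be K3 surfaces for which the
Kuga–Satake [correspondence is algebraic]. Then, every Hodge similarity between `T(S)` and `T(S')` is
algebraic" (Cor. 4.6 at `n = 1`, where the Lefschetz hypothesis "is trivially true").  Rendering: for K3
surfaces `S`, `S'` with `IsKSCorrespondenceAlgebraicBetti`, Fujiki forms `b`, `b'` (`n = 1`: the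
intersection forms up to `ℂˣ`) and `ψ : H²(S(ℂ); ℂ) → H²(S'(ℂ); ℂ)` rational on, bijective from,
type-preserving on and isometric on `transcendentalPart S b` onto `transcendentalPart S' b'`, some `T`
induced by an algebraic cycle on `S' × S` agrees with `ψ` on `transcendentalPart S b`.  A THEOREM in
print (REFEREED: Math. Z. 2023; unproved in the tree; Buskin's unconditional theorem is the isometry
case). [cite: Varesco2023, Thm. 5.3 (§5) with Cor. 4.6, Def. 1.2 and Rem. 4.1]
[cite: Floccari2026, §3.3 Rem. 3.4 (the H²_tr-form of the Kuga–Satake statement for surfaces)] -/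
def Varesco2023_transcendentalHodgeSimilitude_algebraic_of_kugaSatake_K3 : Prop :=
  -- antecedents: the tree's open Kuga–Satake predicate for `S` and for `S'`; nothing is asserted
  ∀ ⦃S S' : Motives.SchemeOver ℂ⦄ (hS : IsK3Surface S) (hS' : IsK3Surface S'),
    IsKSCorrespondenceAlgebraicBetti hS.isSmoothProjective →
    IsKSCorrespondenceAlgebraicBetti hS'.isSmoothProjective →
  ∀ (b : complexBetti S 2 →ₗ[ℂ] complexBetti S 2 →ₗ[ℂ] ℂ)
    (b' : complexBetti S' 2 →ₗ[ℂ] complexBetti S' 2 →ₗ[ℂ] ℂ),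
    IsFujikiForm 1 S b → IsFujikiForm 1 S' b' →
  ∀ (ψ : complexBetti S 2 →ₗ[ℂ] complexBetti S' 2),
    (∀ x ∈ transcendentalPart S b, IsRationalClass x → IsRationalClass (ψ x)) →
    Set.BijOn ψ (transcendentalPart S b) (transcendentalPart S' b') →
    (∀ (i j : ℕ), ∀ x ∈ transcendentalPart S b,
      IsOfHodgeType 2 S 2 i j x → IsOfHodgeType 2 S' 2 i j (ψ x)) →
    (∀ x ∈ transcendentalPart S b, ∀ y ∈ transcendentalPart S b, b' (ψ x) (ψ y) = b x y) →
  ∃ T : complexBetti S 2 →ₗ[ℂ] complexBetti S' 2,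
    IsAlgebraicCorrespondence 2 2 S' S T ∧ ∀ x ∈ transcendentalPart S b, T x = ψ x

namespace Varesco2023_transcendentalHodgeSimilitude_algebraic_of_kugaSatake_K3

/-- **The `transcendentalSubspace` spelling** (the carrier of the tree's K3 records, e.g.
`Floccari2026_associatedK3Surface_kummerType`): the same statement with every clause read on the
cup-orthogonal complements `transcendentalSubspace S`, `transcendentalSubspace S'` of the Néron–Severi
groups — equal to `transcendentalPart S b`, `transcendentalPart S' b'` for Fujiki forms with `n = 1`
(`transcendentalPart_eq_transcendentalSubspace`).  Kernel, modulo the record. [cite: Varesco2023, Thm. 5.3 (§5)] -/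
theorem of_transcendentalSubspace (h : Varesco2023_transcendentalHodgeSimilitude_algebraic_of_kugaSatake_K3)
    {S S' : Motives.SchemeOver ℂ} (hS : IsK3Surface S) (hS' : IsK3Surface S')
    (hKS : IsKSCorrespondenceAlgebraicBetti hS.isSmoothProjective)
    (hKS' : IsKSCorrespondenceAlgebraicBetti hS'.isSmoothProjective)
    {b : complexBetti S 2 →ₗ[ℂ] complexBetti S 2 →ₗ[ℂ] ℂ}
    {b' : complexBetti S' 2 →ₗ[ℂ] complexBetti S' 2 →ₗ[ℂ] ℂ}
    (hb : IsFujikiForm 1 S b) (hb' : IsFujikiForm 1 S' b')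
    {ψ : complexBetti S 2 →ₗ[ℂ] complexBetti S' 2}
    (hψrat : ∀ x ∈ transcendentalSubspace S, IsRationalClass x → IsRationalClass (ψ x))
    (hψbij : Set.BijOn ψ (transcendentalSubspace S) (transcendentalSubspace S'))
    (hψH : ∀ (i j : ℕ), ∀ x ∈ transcendentalSubspace S,
      IsOfHodgeType 2 S 2 i j x → IsOfHodgeType 2 S' 2 i j (ψ x))
    (hψiso : ∀ x ∈ transcendentalSubspace S, ∀ y ∈ transcendentalSubspace S, b' (ψ x) (ψ y) = b x y) :
    ∃ T : complexBetti S 2 →ₗ[ℂ] complexBetti S' 2,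
      IsAlgebraicCorrespondence 2 2 S' S T ∧ ∀ x ∈ transcendentalSubspace S, T x = ψ x := by
  have e₁ := transcendentalPart_eq_transcendentalSubspace hb
  have e₂ := transcendentalPart_eq_transcendentalSubspace hb'
  have key := h hS hS' hKS hKS' b b' hb hb' ψ
  rw [e₁, e₂] at key
  exact key hψrat hψbij hψH hψiso

end Varesco2023_transcendentalHodgeSimilitude_algebraic_of_kugaSatake_K3

end Literature.AlgebraicGeometry.Surfaces

end
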